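import Summits.Ventures.PercRepro.RankLevelSetLevelSixSplit
import Summits.Ventures.PercRepro.SevenThreeQThree

/-!
# PercRepro — THEOREMS C₄ / C₅ / C₆ WITH THE SPLIT COUNT, UNCONDITIONAL: C-025 at levels `4` / `5` / `6` for every
finite matroid and every `p ≥ 43` / `175` / `1225` (night-1, gen 4)

`proofs/NIGHT-1-C025-induction.md` §15.15: the split chain composed with the q = 3 row `c025_three_all` (p3,
SevenThreeQThree; ADDENDUM 19). Axioms: standard.
-/

open scoped Matroid

namespace PercRepro

namespace ThmN

variable {α : Type}

/-- **THEOREM C₄, split count**: every finite matroid satisfies C-025 at level `4` for every `p ≥ 43`. -/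
theorem c025_four_large_split (M : Matroid α) [M.Finite] (p : ℕ) (hp : 43 ≤ p) : RLS M p 4 :=
  c025_four_of_three_split (fun M _ p hp => SevenThree.c025_three_all M p hp) M p hp

/-- **THEOREM C₅, split count**: every finite matroid satisfies C-025 at level `5` for every `p ≥ 175`. -/
theorem c025_five_large_split (M : Matroid α) [M.Finite] (p : ℕ) (hp : 175 ≤ p) : RLS M p 5 :=
  c025_five_of_four_split (fun M _ p hp => c025_four_large_split M p hp) M p hp

/-- **THEOREM C₆, split count**: every finite matroid satisfies C-025 at level `6` for every `p ≥ 1225`. -/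
theorem c025_six_large_split (M : Matroid α) [M.Finite] (p : ℕ) (hp : 1225 ≤ p) : RLS M p 6 :=
  c025_six_of_five_split (fun M _ p hp => c025_five_large_split M p hp) M p hp

end ThmN

end PercRepro
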